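import Literature.MathematicalPhysics.QuantumLattice.HeatKernelGroup
import Literature.MathematicalPhysics.QuantumFieldTheory.StrongCouplingActivities
import HarnessLib

/-!
# Convolution by continuous central kernels on a compact group (heat-kernel uniqueness, brick 1)

First brick of the proof of
`Literature.MathematicalPhysics.QuantumLattice.isGroupHeatKernel_unique_up_to_scale` (Hunt 1956,
Thm 5.1 with Schur's lemma): the elementary theory of the convolution operators
`(T_k f)(x) = ∫ k(h) f(h⁻¹ x) dh` (`haarConv k f`) on a compact group `G` with its Haar probability
measure, for a *continuous* kernel `k` — in the application `k = p_t`, a heat kernel in the sense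
of `IsGroupHeatKernel`.

* `measurable_of_continuous_prod`: a continuous real function on the product of two compact
  Hausdorff spaces is measurable for the **product of the Borel σ-algebras** (no second
  countability): it is a uniform limit of finite sums `Σ uᵢ(x) vᵢ(y)` (Stone–Weierstrass). This is
  what makes Fubini available on `G × G` for an arbitrary compact Hausdorff group.
* `haarConv`: the two formulas `∫ k(h) f(h⁻¹x) dh = ∫ k(x h⁻¹) f(h) dh`; uniform continuity of
  continuous functions on a compact group (`exists_nhds_one_forall_abs_sub_lt`, tube lemma);
  equicontinuity and continuity of `haarConv k f` for integrable `f`; sup bound.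
* equivariance: `haarConv k` commutes with right translations, and with left translations when `k`
  is central; two central kernels commute under convolution.
* the semigroup / associativity law `T_{k₁} (T_{k₂} f) = T_{k₁ ⋆ k₂} f` and the symmetry
  `∫ (T_k f) g = ∫ f (T_k g)` for symmetric `k` (Fubini on `G × G`, continuous data).
* for a heat kernel `p`: `∫ f p_t = (T_{p_t} f)(1)` and the **approximate identity** property
  `T_{p_t} f → f` uniformly as `t → 0⁺` for `f ∈ C(G, ℝ)` (from `noJumps` and `integral_eq_one`).

These are the function-level inputs for the `L²` spectral theory of the heat semigroup (next
brick). Sources: E. M. Stein, *Topics in Harmonic Analysis* (1970), Ch. II §2; G. A. Hunt, Trans.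
AMS **81** (1956) §5; standard harmonic analysis on compact groups (Folland, *A Course in Abstract
Harmonic Analysis*, §2.5, §5.2).

Design: the Haar probability measure is `QuantumFieldTheory.haarProbability G` (explicit measure,
no `MeasureSpace G`), with its invariance instances from `StrongCouplingActivities`
(`IsMulRightInvariant`, `IsInvInvariant`). No new definitions of mathematical content besides the
abbreviation `haarConv`; no named facts.
-/

open MeasureTheory Filter Topology
open Literature.MathematicalPhysics.QuantumFieldTheory (haarProbability integral_haar_conj_eq)

noncomputable section

namespace Literature.MathematicalPhysics.QuantumLattice

/-! ### Product measurability of continuous functions on compact Hausdorff spaces -/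

section ProductMeasurability

variable {X Y : Type*} [TopologicalSpace X] [CompactSpace X] [T2Space X] [MeasurableSpace X]
  [OpensMeasurableSpace X] [TopologicalSpace Y] [CompactSpace Y] [T2Space Y] [MeasurableSpace Y]
  [OpensMeasurableSpace Y]

/-- The subalgebra of `C(X × Y, ℝ)` of functions measurable for the product σ-algebra. [folklore] -/
def prodMeasurableSubalgebra (X Y : Type*) [TopologicalSpace X] [MeasurableSpace X]
    [TopologicalSpace Y] [MeasurableSpace Y] : Subalgebra ℝ C(X × Y, ℝ) where
  carrier := {f | Measurable (f : X × Y → ℝ)}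
  mul_mem' ha hb := ha.mul hb
  add_mem' ha hb := ha.add hb
  algebraMap_mem' _ := measurable_const

omit [CompactSpace X] [CompactSpace Y] [T2Space Y] [MeasurableSpace X] [OpensMeasurableSpace X]
  [MeasurableSpace Y] [OpensMeasurableSpace Y] in
/-- In a compact Hausdorff space two distinct points are separated by a continuous real function
(Urysohn). [folklore] -/
theorem exists_continuous_apply_ne [CompactSpace X] {x x' : X} (h : x ≠ x') :
    ∃ u : C(X, ℝ), u x ≠ u x' := by
  obtain ⟨u, hu0, hu1, -⟩ := exists_continuous_zero_one_of_isClosed (isClosed_singleton (x := x))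
    (isClosed_singleton (x := x')) (Set.disjoint_singleton.mpr h)
  refine ⟨u, ?_⟩
  rw [hu0 (Set.mem_singleton x), hu1 (Set.mem_singleton x')]
  simp

/-- **Continuous functions on a product of compact Hausdorff spaces are product-measurable.**
For `X`, `Y` compact Hausdorff with their Borel σ-algebras (or any finer measurable structure
making open sets measurable), every continuous `F : X × Y → ℝ` is measurable for the *product*
σ-algebra `𝓑(X) ⊗ 𝓑(Y)` — although `𝓑(X × Y)` may be strictly larger when neither factor is
second countable. Proof: the subalgebra generated by the functions `u ∘ fst`, `v ∘ snd`
(`u ∈ C(X, ℝ)`, `v ∈ C(Y, ℝ)`) separates points, hence is dense in `C(X × Y, ℝ)` by the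
Stone–Weierstrass theorem; its members are product-measurable, and a uniform (so pointwise) limit
of a sequence of measurable real functions is measurable. [folklore] -/
theorem measurable_of_continuous_prod {F : X × Y → ℝ} (hF : Continuous F) : Measurable F := by
  let S : Set C(X × Y, ℝ) :=
    Set.range (fun u : C(X, ℝ) => u.comp ContinuousMap.fst) ∪
      Set.range (fun v : C(Y, ℝ) => v.comp ContinuousMap.snd)
  let A : Subalgebra ℝ C(X × Y, ℝ) := Algebra.adjoin ℝ S
  have hAM : A ≤ prodMeasurableSubalgebra X Y := by
    refine Algebra.adjoin_le ?_
    rintro f (⟨u, rfl⟩ | ⟨v, rfl⟩)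
    · exact u.continuous.measurable.comp measurable_fst
    · exact v.continuous.measurable.comp measurable_snd
  have hsep : A.SeparatesPoints := by
    rintro ⟨x, y⟩ ⟨x', y'⟩ hne
    by_cases hx : x = x'
    · subst hx
      have hy : y ≠ y' := fun h => hne (by rw [h])
      obtain ⟨v, hv⟩ := exists_continuous_apply_ne hy
      refine ⟨v.comp ContinuousMap.snd, ⟨v.comp ContinuousMap.snd,
        Algebra.subset_adjoin (Or.inr ⟨v, rfl⟩), rfl⟩, ?_⟩
      simpa using hv
    · obtain ⟨u, hu⟩ := exists_continuous_apply_ne hx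
      refine ⟨u.comp ContinuousMap.fst, ⟨u.comp ContinuousMap.fst,
        Algebra.subset_adjoin (Or.inl ⟨u, rfl⟩), rfl⟩, ?_⟩
      simpa using hu
  have hdense : A.topologicalClosure = ⊤ :=
    ContinuousMap.subalgebra_topologicalClosure_eq_top_of_separatesPoints A hsep
  have hmem : (⟨F, hF⟩ : C(X × Y, ℝ)) ∈ closure (A : Set C(X × Y, ℝ)) := by
    rw [← Subalgebra.topologicalClosure_coe, hdense]
    trivial
  obtain ⟨a, haA, hlim⟩ := mem_closure_iff_seq_limit.mp hmem
  have hptw : Tendsto (fun n => (a n : X × Y → ℝ)) atTop (𝓝 F) := by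
    rw [tendsto_pi_nhds]
    intro z
    exact ((continuous_eval_const z).tendsto _).comp hlim
  exact measurable_of_tendsto_metrizable (fun n => hAM (haA n)) hptw

/-- A continuous real function on the product of two compact Hausdorff spaces is integrable for
the product of two finite Borel measures (product-measurable by `measurable_of_continuous_prod`,
and bounded). [folklore] -/
theorem integrable_prod_of_continuous {F : X × Y → ℝ} (hF : Continuous F) (μ : Measure X)
    (ν : Measure Y) [IsFiniteMeasure μ] [IsFiniteMeasure ν] : Integrable F (μ.prod ν) := by
  obtain ⟨C, hC⟩ := isCompact_univ.exists_bound_of_continuousOn hF.continuousOn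
  exact Integrable.mono' (integrable_const C) (measurable_of_continuous_prod hF).aestronglyMeasurable
    (ae_of_all _ fun z => hC z (Set.mem_univ z))

end ProductMeasurability

/-! ### Convolution by a continuous kernel -/

variable {G : Type*} [Group G] [TopologicalSpace G] [IsTopologicalGroup G] [CompactSpace G]
  [MeasurableSpace G] [BorelSpace G]

/-- Convolution of a kernel `k` with a function `f` on a compact group, with respect to the Haar
probability measure: `(k ⋆ f)(x) = ∫ k(h) f(h⁻¹ x) dh` (Folland, *Abstract Harmonic Analysis*,
§2.5; this is the operator `f ↦ p_t ⋆ f` of the heat semigroup when `k = p_t`). Same formula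
as Mathlib's `MeasureTheory.mlconvolution` (`f ⋆ₘₗ[μ] g`, `Mathlib.Analysis.LConvolution`), which
however is the *lower Lebesgue* integral of `ℝ≥0∞`-valued functions; here we need the
real-valued Bochner integral (signed `f`), for the fixed measure `haarProbability G`. Junk value
`0` where the integrand is not integrable. [folklore] -/
def haarConv (k f : G → ℝ) : G → ℝ :=
  fun x => ∫ h, k h * f (h⁻¹ * x) ∂(haarProbability G)

/-- Unfolding `haarConv`. [folklore] -/
theorem haarConv_apply (k f : G → ℝ) (x : G) :
    haarConv k f x = ∫ h, k h * f (h⁻¹ * x) ∂(haarProbability G) := rfl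

/-- The second convolution formula `∫ k(h) f(h⁻¹x) dh = ∫ k(x h⁻¹) f(h) dh` (substitute
`h ↦ x h⁻¹`, using inversion invariance and right invariance of the Haar measure of a compact
group). [folklore] -/
theorem haarConv_eq_integral_mul_inv (k f : G → ℝ) (x : G) :
    haarConv k f x = ∫ h, k (x * h⁻¹) * f h ∂(haarProbability G) := by
  rw [haarConv_apply]
  have h1 := integral_inv_eq_self (fun h => k h * f (h⁻¹ * x)) (haarProbability G)
  rw [← h1]
  have h2 := integral_mul_right_eq_self (μ := haarProbability G)
    (fun h => k h⁻¹ * f (h⁻¹⁻¹ * x)) x⁻¹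
  rw [← h2]
  refine integral_congr_ae (Eventually.of_forall fun h => ?_)
  simp [mul_assoc]

omit [MeasurableSpace G] [BorelSpace G] in
/-- **Uniform continuity on a compact group.** A continuous function `k` on a compact group is
left-uniformly continuous: for every `ε > 0` there is a neighbourhood `U` of `1` with
`|k(u x) - k(x)| < ε` for all `u ∈ U` and all `x` (tube lemma applied to the open set
`{(u, x) | |k(ux) - k(x)| < ε} ⊇ {1} × G`). [folklore] -/
theorem exists_nhds_one_forall_abs_sub_lt {k : G → ℝ} (hk : Continuous k) {ε : ℝ} (hε : 0 < ε) :
    ∃ U ∈ 𝓝 (1 : G), ∀ u ∈ U, ∀ x, |k (u * x) - k x| < ε := by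
  let W : Set (G × G) := {z | |k (z.1 * z.2) - k z.2| < ε}
  have hW : IsOpen W := by
    have hc : Continuous fun z : G × G => |k (z.1 * z.2) - k z.2| := by fun_prop
    exact isOpen_lt hc continuous_const
  have hsub : ({1} : Set G) ×ˢ (Set.univ : Set G) ⊆ W := by
    rintro ⟨u, x⟩ ⟨hu, -⟩
    rw [Set.mem_singleton_iff] at hu
    subst hu
    simpa [W] using hε
  obtain ⟨U, V, hU, -, h1U, hV, hUV⟩ :=
    generalized_tube_lemma isCompact_singleton isCompact_univ hW hsub
  refine ⟨U, hU.mem_nhds (h1U (Set.mem_singleton 1)), fun u hu x => ?_⟩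
  have : (u, x) ∈ W := hUV (Set.mk_mem_prod hu (hV (Set.mem_univ x)))
  simpa [W] using this

omit [Group G] [IsTopologicalGroup G] [MeasurableSpace G] [BorelSpace G] in
/-- A continuous function on a compact group is bounded. [folklore] -/
theorem exists_forall_abs_le_of_continuous {k : G → ℝ} (hk : Continuous k) :
    ∃ C, 0 ≤ C ∧ ∀ x, |k x| ≤ C := by
  obtain ⟨C, hC⟩ := isCompact_univ.exists_bound_of_continuousOn hk.continuousOn
  refine ⟨max C 0, le_max_right _ _, fun x => ?_⟩
  exact (Real.norm_eq_abs _ ▸ hC x (Set.mem_univ x)).trans (le_max_left _ _)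

/-- The integrand `h ↦ k(x h⁻¹) f(h)` of the second convolution formula is integrable when `k` is
continuous and `f` is integrable. [folklore] -/
theorem integrable_mul_inv_mul {k : G → ℝ} (hk : Continuous k) {f : G → ℝ}
    (hf : Integrable f (haarProbability G)) (x : G) :
    Integrable (fun h => k (x * h⁻¹) * f h) (haarProbability G) := by
  obtain ⟨C, -, hC⟩ := exists_forall_abs_le_of_continuous hk
  refine hf.bdd_mul (c := C) ?_ (ae_of_all _ fun h => ?_)
  · exact (hk.comp (continuous_const.mul continuous_inv)).aestronglyMeasurable
  · simpa [Real.norm_eq_abs] using hC (x * h⁻¹)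

/-- **Equicontinuity of convolutions.** For a continuous kernel `k` and `ε > 0` there is a
neighbourhood `U` of `1` such that `|(k ⋆ f)(u x) - (k ⋆ f)(x)| ≤ ε ∫ |f|` for every integrable
`f`, all `u ∈ U` and all `x` (from the second convolution formula and uniform continuity of `k`).
[folklore] -/
theorem exists_nhds_one_forall_abs_haarConv_sub_le {k : G → ℝ} (hk : Continuous k) {ε : ℝ}
    (hε : 0 < ε) :
    ∃ U ∈ 𝓝 (1 : G), ∀ f : G → ℝ, Integrable f (haarProbability G) → ∀ u ∈ U, ∀ x,
      |haarConv k f (u * x) - haarConv k f x| ≤ ε * ∫ h, |f h| ∂(haarProbability G) := by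
  obtain ⟨U, hU, hk'⟩ := exists_nhds_one_forall_abs_sub_lt hk hε
  refine ⟨U, hU, fun f hf u hu x => ?_⟩
  rw [haarConv_eq_integral_mul_inv, haarConv_eq_integral_mul_inv,
    ← integral_sub (integrable_mul_inv_mul hk hf _) (integrable_mul_inv_mul hk hf _)]
  calc |∫ h, (k (u * x * h⁻¹) * f h - k (x * h⁻¹) * f h) ∂haarProbability G|
      ≤ ∫ h, |k (u * x * h⁻¹) * f h - k (x * h⁻¹) * f h| ∂haarProbability G :=
        abs_integral_le_integral_abs
    _ ≤ ∫ h, ε * |f h| ∂haarProbability G := by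
        refine integral_mono_of_nonneg (ae_of_all _ fun h => abs_nonneg _)
          (hf.abs.const_mul ε) (ae_of_all _ fun h => ?_)
        have := hk' u hu (x * h⁻¹)
        simp only [← sub_mul, abs_mul, mul_assoc] at this ⊢
        exact mul_le_mul_of_nonneg_right this.le (abs_nonneg _)
    _ = ε * ∫ h, |f h| ∂haarProbability G := integral_const_mul _ _

/-- The convolution of a continuous kernel with an integrable function is continuous. [folklore] -/
theorem continuous_haarConv {k : G → ℝ} (hk : Continuous k) {f : G → ℝ}
    (hf : Integrable f (haarProbability G)) : Continuous (haarConv k f) := by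
  refine continuous_iff_continuousAt.mpr fun x => ?_
  rw [ContinuousAt, Metric.tendsto_nhds]
  intro ε hε
  set I := ∫ h, |f h| ∂(haarProbability G)
  have hI : 0 ≤ I := integral_nonneg fun h => abs_nonneg _
  obtain ⟨U, hU, hUf⟩ := exists_nhds_one_forall_abs_haarConv_sub_le hk
    (show 0 < ε / (2 * (I + 1)) by positivity)
  have hmap : Tendsto (fun y => y * x⁻¹) (𝓝 x) (𝓝 1) := by
    have : Continuous fun y : G => y * x⁻¹ := by fun_prop
    simpa using this.tendsto x
  filter_upwards [hmap hU] with y hy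
  have key := hUf f hf (y * x⁻¹) hy x
  rw [inv_mul_cancel_right] at key
  rw [Real.dist_eq]
  refine key.trans_lt ?_
  calc ε / (2 * (I + 1)) * I ≤ ε / (2 * (I + 1)) * (I + 1) := by gcongr; linarith
    _ = ε / 2 := by field_simp
    _ < ε := half_lt_self hε

/-- Sup bound `|(k ⋆ f)(x)| ≤ (sup |k|) ∫ |f|` for integrable `f`. [folklore] -/
theorem abs_haarConv_le {k : G → ℝ} {C : ℝ} (hC : ∀ x, |k x| ≤ C) {f : G → ℝ}
    (hf : Integrable f (haarProbability G)) (x : G) :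
    |haarConv k f x| ≤ C * ∫ h, |f h| ∂(haarProbability G) := by
  rw [haarConv_eq_integral_mul_inv]
  calc |∫ h, k (x * h⁻¹) * f h ∂haarProbability G|
      ≤ ∫ h, |k (x * h⁻¹) * f h| ∂haarProbability G := abs_integral_le_integral_abs
    _ ≤ ∫ h, C * |f h| ∂haarProbability G := by
        refine integral_mono_of_nonneg (ae_of_all _ fun h => abs_nonneg _) (hf.abs.const_mul C)
          (ae_of_all _ fun h => ?_)
        simp only [abs_mul]
        exact mul_le_mul_of_nonneg_right (hC _) (abs_nonneg _)
    _ = C * ∫ h, |f h| ∂haarProbability G := integral_const_mul _ _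

/-! ### Equivariance and commutation -/

/-- Convolution commutes with right translations: `k ⋆ (f(· g)) = (k ⋆ f)(· g)`. [folklore] -/
theorem haarConv_comp_mul_right (k f : G → ℝ) (g x : G) :
    haarConv k (fun y => f (y * g)) x = haarConv k f (x * g) := by
  simp only [haarConv_apply, mul_assoc]

/-- For a **central** kernel (`k(h g h⁻¹) = k(g)`), convolution commutes with left translations:
`k ⋆ (f(g ·)) = (k ⋆ f)(g ·)` (substitute `h ↦ g h g⁻¹`, a Haar-preserving map). [folklore] -/
theorem haarConv_comp_mul_left {k : G → ℝ} (hk : ∀ g h, k (h * g * h⁻¹) = k g) (f : G → ℝ)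
    (g x : G) : haarConv k (fun y => f (g * y)) x = haarConv k f (g * x) := by
  simp only [haarConv_apply]
  rw [← integral_haar_conj_eq (fun h => k h * f (h⁻¹ * (g * x))) g g⁻¹]
  refine integral_congr_ae (Eventually.of_forall fun h => ?_)
  simp only [mul_inv_rev, inv_inv, hk]
  congr 1
  simp [mul_assoc]

omit [TopologicalSpace G] [IsTopologicalGroup G] [CompactSpace G] [MeasurableSpace G] [BorelSpace G] in
/-- For a central kernel, `k(x h⁻¹) = k(h⁻¹ x)`. [folklore] -/
theorem central_apply_mul_inv {k : G → ℝ} (hk : ∀ g h, k (h * g * h⁻¹) = k g) (x h : G) :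
    k (x * h⁻¹) = k (h⁻¹ * x) := by
  have := hk (h⁻¹ * x) h
  rwa [mul_inv_cancel_left] at this

/-- **Central kernels commute under convolution**: if `k₁` is central then
`k₁ ⋆ k₂ = k₂ ⋆ k₁` pointwise (second convolution formula and `k₁(x h⁻¹) = k₁(h⁻¹ x)`).
In particular two heat kernels `p_s`, `q_t` of the same compact group commute. [folklore] -/
theorem haarConv_comm_of_central {k₁ : G → ℝ} (hk₁ : ∀ g h, k₁ (h * g * h⁻¹) = k₁ g)
    (k₂ : G → ℝ) : haarConv k₁ k₂ = haarConv k₂ k₁ := by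
  funext x
  rw [haarConv_eq_integral_mul_inv, haarConv_apply]
  refine integral_congr_ae (Eventually.of_forall fun h => ?_)
  simp only [central_apply_mul_inv hk₁, mul_comm]

/-- `(k ⋆ f)(1) = ∫ k(h⁻¹) f(h) dh`; for a **symmetric** kernel (`k(g⁻¹) = k(g)`) this is
`∫ f k`: the pairing of `f` with the measure `k dh` is the value of `k ⋆ f` at the identity.
[folklore] -/
theorem haarConv_apply_one_of_symm {k : G → ℝ} (hk : ∀ g, k g⁻¹ = k g) (f : G → ℝ) :
    haarConv k f 1 = ∫ h, f h * k h ∂(haarProbability G) := by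
  rw [haarConv_eq_integral_mul_inv]
  refine integral_congr_ae (Eventually.of_forall fun h => ?_)
  simp only [one_mul, hk, mul_comm]

/-! ### Associativity (semigroup law) and symmetry: Fubini on `G × G` -/

section Fubini

variable [T2Space G]

/-- Integrability on `G × G` (product of the Borel σ-algebras, product Haar probability) of a
continuous function of two variables — the case of `measurable_of_continuous_prod` used below.
[folklore] -/
theorem integrable_prod_haar_of_continuous {F : G × G → ℝ} (hF : Continuous F) :
    Integrable F ((haarProbability G).prod (haarProbability G)) :=
  integrable_prod_of_continuous hF _ _

/-- **Associativity / semigroup law.** For continuous kernels `k₁`, `k₂` and continuous `f`,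
`k₁ ⋆ (k₂ ⋆ f) = (k₁ ⋆ k₂) ⋆ f`; with `k₁ = p_s`, `k₂ = p_t` and the Chapman–Kolmogorov identity
`p_s ⋆ p_t = p_{s+t}` this is `T_s T_t = T_{s+t}` on `C(G)` (Stein 1970, Ch. II §2). Proof:
left invariance `k ↦ h k` in the inner integral, then Fubini. [folklore] -/
theorem haarConv_haarConv {k₁ k₂ f : G → ℝ} (hk₁ : Continuous k₁) (hk₂ : Continuous k₂)
    (hf : Continuous f) : haarConv k₁ (haarConv k₂ f) = haarConv (haarConv k₁ k₂) f := by
  funext x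
  -- inner substitution: `∫ k₂(h⁻¹ k) f(k⁻¹ x) dk = ∫ k₂(k) f(k⁻¹ h⁻¹ x) dk = (k₂ ⋆ f)(h⁻¹ x)`
  have hinner : ∀ h, haarConv k₂ f (h⁻¹ * x) =
      ∫ k, k₂ (h⁻¹ * k) * f (k⁻¹ * x) ∂(haarProbability G) := by
    intro h
    rw [haarConv_apply]
    conv_rhs => rw [← integral_mul_left_eq_self _ h]
    refine integral_congr_ae (Eventually.of_forall fun k => ?_)
    simp [mul_assoc]
  rw [haarConv_apply]
  simp_rw [hinner]
  rw [haarConv_apply]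
  simp only [haarConv_apply]
  -- both sides are iterated integrals of `F(h,k) = k₁(h) k₂(h⁻¹k) f(k⁻¹x)`
  have hF : Continuous fun z : G × G => k₁ z.1 * (k₂ (z.1⁻¹ * z.2) * f (z.2⁻¹ * x)) := by
    fun_prop
  have hI : Integrable (Function.uncurry fun h k : G => k₁ h * (k₂ (h⁻¹ * k) * f (k⁻¹ * x)))
      ((haarProbability G).prod (haarProbability G)) :=
    integrable_prod_haar_of_continuous hF
  have hswap := integral_integral_swap hI
  simp_rw [← integral_const_mul]
  rw [hswap]
  refine integral_congr_ae (Eventually.of_forall fun k => ?_)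
  dsimp only
  rw [← integral_mul_const]
  refine integral_congr_ae (Eventually.of_forall fun h => ?_)
  dsimp only
  ring

/-- **Symmetry.** For a continuous symmetric kernel (`k(g⁻¹) = k(g)`) the convolution operator is
symmetric with respect to the Haar pairing: `∫ (k ⋆ f) g = ∫ f (k ⋆ g)` for continuous `f`, `g`
(second convolution formula, `k(x h⁻¹) = k(h x⁻¹)`, Fubini). [folklore] -/
theorem integral_haarConv_mul_eq {k f g : G → ℝ} (hk : Continuous k) (hks : ∀ y, k y⁻¹ = k y)
    (hf : Continuous f) (hg : Continuous g) :
    ∫ x, haarConv k f x * g x ∂(haarProbability G) =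
      ∫ x, f x * haarConv k g x ∂(haarProbability G) := by
  simp only [haarConv_eq_integral_mul_inv]
  have hF : Continuous fun z : G × G => k (z.1 * z.2⁻¹) * f z.2 * g z.1 := by fun_prop
  have hI : Integrable (Function.uncurry fun x h : G => k (x * h⁻¹) * f h * g x)
      ((haarProbability G).prod (haarProbability G)) :=
    integrable_prod_haar_of_continuous hF
  have hswap := integral_integral_swap hI
  simp_rw [← integral_mul_const]
  rw [hswap]
  refine integral_congr_ae (Eventually.of_forall fun y => ?_)
  dsimp only
  rw [← integral_const_mul]
  refine integral_congr_ae (Eventually.of_forall fun x => ?_)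
  dsimp only
  have : k (x * y⁻¹) = k (y * x⁻¹) := by rw [← hks, mul_inv_rev, inv_inv]
  rw [this]
  ring

end Fubini

/-! ### Heat kernels: pairing with `p_t` and the approximate identity -/

namespace IsGroupHeatKernel

variable {p : ℝ → G → ℝ}

/-- `∫ f p_t = (p_t ⋆ f)(1)` for a heat kernel (symmetry of `p_t`). [folklore] -/
theorem integral_mul_eq_haarConv_one (hp : IsGroupHeatKernel p) {t : ℝ} (ht : 0 < t)
    (f : G → ℝ) : ∫ h, f h * p t h ∂(haarProbability G) = haarConv (p t) f 1 :=
  (haarConv_apply_one_of_symm (hp.symm t ht) f).symm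

/-- The mass of a heat kernel outside a neighbourhood of `1` tends to `0` as `t → 0⁺`
(`noJumps` gives even `t⁻¹ ∫_{Uᶜ} p_t → 0`). [folklore] -/
theorem tendsto_setIntegral_compl (hp : IsGroupHeatKernel p) {U : Set G} (hU : U ∈ 𝓝 (1 : G)) :
    Tendsto (fun t => ∫ g in Uᶜ, p t g ∂(haarProbability G)) (𝓝[>] 0) (𝓝 0) := by
  have h1 := hp.noJumps U hU
  have h2 : Tendsto (fun t : ℝ => t) (𝓝[>] 0) (𝓝 0) := nhdsWithin_le_nhds
  have h3 := h2.mul h1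
  rw [mul_zero] at h3
  refine h3.congr' ?_
  filter_upwards [self_mem_nhdsWithin] with t ht
  rw [← mul_assoc, mul_inv_cancel₀ (ne_of_gt ht), one_mul]

/-- `(p_t ⋆ f)(x) - f(x) = ∫ p_t(h) (f(h⁻¹x) - f(x)) dh` (since `∫ p_t = 1`). [folklore] -/
theorem haarConv_sub_eq (hp : IsGroupHeatKernel p) {t : ℝ} (ht : 0 < t) {f : G → ℝ}
    (hf : Continuous f) (x : G) :
    haarConv (p t) f x - f x =
      ∫ h, p t h * (f (h⁻¹ * x) - f x) ∂(haarProbability G) := by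
  have hi1 : Integrable (fun h => p t h * f (h⁻¹ * x)) (haarProbability G) :=
    ((hp.continuous ht).mul (hf.comp (continuous_inv.mul continuous_const))).integrable_of_hasCompactSupport
      (HasCompactSupport.of_compactSpace _)
  have hi2 : Integrable (fun h => p t h * f x) (haarProbability G) :=
    (hp.integrable ht).mul_const _
  simp only [mul_sub]
  rw [integral_sub hi1 hi2, integral_mul_const, hp.integral_eq_one t ht, one_mul, haarConv_apply]

/-- **Approximate identity.** For a heat kernel `p` and `f ∈ C(G, ℝ)`, `p_t ⋆ f → f` uniformly
on `G` as `t → 0⁺`: split `∫ p_t(h)(f(h⁻¹x) - f(x)) dh` over a neighbourhood `U` of `1` on which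
`|f(h⁻¹x) - f(x)| < ε` (uniform continuity) and its complement, of `p_t`-mass `→ 0`
(Stein 1970, Ch. II §2). [cite: Stein1970, Ch. II §2] -/
theorem tendstoUniformly_haarConv (hp : IsGroupHeatKernel p) (f : C(G, ℝ)) :
    TendstoUniformly (fun t x => haarConv (p t) f x) f (𝓝[>] 0) := by
  rw [Metric.tendstoUniformly_iff]
  intro ε hε
  obtain ⟨C, hC0, hC⟩ := exists_forall_abs_le_of_continuous f.continuous
  -- uniform continuity of `f`: `|f(u x) - f(x)| < ε/2` for `u ∈ U`
  obtain ⟨U, hU, hUf⟩ := exists_nhds_one_forall_abs_sub_lt f.continuous (half_pos hε)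
  -- a measurable (open) symmetric-free version: work with `V = interior U`, and `h⁻¹ ∈ V`
  set V : Set G := (fun h => h⁻¹) ⁻¹' interior U with hV
  have hVo : IsOpen V := isOpen_interior.preimage continuous_inv
  have hV1 : V ∈ 𝓝 (1 : G) := hVo.mem_nhds (by simp [hV, mem_interior_iff_mem_nhds, hU])
  have hVm : MeasurableSet V := hVo.measurableSet
  have hmass := hp.tendsto_setIntegral_compl hV1
  rw [Metric.tendsto_nhds] at hmass
  have hδ : 0 < ε / (4 * (C + 1)) := by positivity
  filter_upwards [hmass _ hδ, self_mem_nhdsWithin] with t hmt ht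
  intro x
  rw [Real.dist_eq, abs_sub_comm, hp.haarConv_sub_eq ht f.continuous x]
  have hpt := hp.continuous ht
  have hint : Integrable (fun h => p t h * (f (h⁻¹ * x) - f x)) (haarProbability G) :=
    (hpt.mul ((f.continuous.comp (continuous_inv.mul continuous_const)).sub
      continuous_const)).integrable_of_hasCompactSupport (HasCompactSupport.of_compactSpace _)
  -- pointwise bound by `ε/2 · p_t + 2C · 1_{Vᶜ} p_t`
  have hbound : ∀ h, |p t h * (f (h⁻¹ * x) - f x)| ≤
      ε / 2 * p t h + 2 * C * Set.indicator Vᶜ (p t) h := by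
    intro h
    rw [abs_mul, abs_of_nonneg (hp.nonneg t ht h)]
    by_cases hh : h ∈ V
    · have : |f (h⁻¹ * x) - f x| < ε / 2 := hUf h⁻¹ (interior_subset hh) x
      rw [Set.indicator_of_notMem (fun hc => (Set.mem_compl_iff V h).mp hc hh), mul_zero, add_zero,
        mul_comm]
      exact mul_le_mul_of_nonneg_right this.le (hp.nonneg t ht h)
    · rw [Set.indicator_of_mem (Set.mem_compl hh)]
      have h2 : |f (h⁻¹ * x) - f x| ≤ 2 * C := by
        calc |f (h⁻¹ * x) - f x| ≤ |f (h⁻¹ * x)| + |f x| := abs_sub _ _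
          _ ≤ C + C := add_le_add (hC _) (hC _)
          _ = 2 * C := by ring
      calc p t h * |f (h⁻¹ * x) - f x| ≤ p t h * (2 * C) :=
            mul_le_mul_of_nonneg_left h2 (hp.nonneg t ht h)
        _ = 0 + 2 * C * p t h := by ring
        _ ≤ ε / 2 * p t h + 2 * C * p t h := by
            gcongr; exact mul_nonneg (half_pos hε).le (hp.nonneg t ht h)
  have hind : Integrable (fun h => Set.indicator Vᶜ (p t) h) (haarProbability G) :=
    (hp.integrable ht).indicator hVm.compl
  calc |∫ h, p t h * (f (h⁻¹ * x) - f x) ∂haarProbability G|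
      ≤ ∫ h, |p t h * (f (h⁻¹ * x) - f x)| ∂haarProbability G := abs_integral_le_integral_abs
    _ ≤ ∫ h, (ε / 2 * p t h + 2 * C * Set.indicator Vᶜ (p t) h) ∂haarProbability G :=
        integral_mono_of_nonneg (ae_of_all _ fun h => abs_nonneg _)
          (((hp.integrable ht).const_mul _).add (hind.const_mul _)) (ae_of_all _ hbound)
    _ = ε / 2 + 2 * C * ∫ h in Vᶜ, p t h ∂haarProbability G := by
        rw [integral_add ((hp.integrable ht).const_mul _) (hind.const_mul _), integral_const_mul,
          integral_const_mul, hp.integral_eq_one t ht, mul_one, integral_indicator hVm.compl]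
    _ < ε := by
        set a := ε / (4 * (C + 1)) with ha_def
        have hm : |∫ h in Vᶜ, p t h ∂haarProbability G| < a := by
          simpa [Real.dist_eq] using hmt
        have hm' : ∫ h in Vᶜ, p t h ∂haarProbability G ≤ a := ((le_abs_self _).trans_lt hm).le
        have hC1 : 0 < C + 1 := by linarith
        have ha : 4 * (C + 1) * a = ε := by rw [ha_def]; field_simp
        have ha' : ε = 4 * (C * a) + 4 * a := by rw [← ha]; ring
        have hapos : 0 < a := hδ
        have h2 : 2 * C * ∫ h in Vᶜ, p t h ∂haarProbability G ≤ 2 * C * a := by gcongr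
        nlinarith

/-- The approximate identity in `ε`-form: for `f ∈ C(G, ℝ)` and `ε > 0`, eventually as `t → 0⁺`,
`|(p_t ⋆ f)(x) - f(x)| < ε` for all `x`. [folklore] -/
theorem eventually_forall_abs_haarConv_sub_lt (hp : IsGroupHeatKernel p) (f : C(G, ℝ)) {ε : ℝ}
    (hε : 0 < ε) : ∀ᶠ t in 𝓝[>] 0, ∀ x, |haarConv (p t) f x - f x| < ε := by
  have := (Metric.tendstoUniformly_iff.mp (hp.tendstoUniformly_haarConv f)) ε hε
  filter_upwards [this] with t ht x
  rw [← Real.dist_eq, dist_comm]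
  exact ht x

/-- `p_t ⋆ f` is continuous for `t > 0` and integrable `f`. [folklore] -/
theorem continuous_haarConv (hp : IsGroupHeatKernel p) {t : ℝ} (ht : 0 < t) {f : G → ℝ}
    (hf : Integrable f (haarProbability G)) : Continuous (haarConv (p t) f) :=
  QuantumLattice.continuous_haarConv (hp.continuous ht) hf

/-- `p_t ⋆` commutes with left translations (centrality of `p_t`). [folklore] -/
theorem haarConv_comp_mul_left (hp : IsGroupHeatKernel p) {t : ℝ} (ht : 0 < t) (f : G → ℝ)
    (g x : G) : haarConv (p t) (fun y => f (g * y)) x = haarConv (p t) f (g * x) :=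
  QuantumLattice.haarConv_comp_mul_left (fun g' h => hp.central t ht g' h) f g x

/-- **Chapman–Kolmogorov for the operators**: `p_s ⋆ (p_t ⋆ f) = p_{s+t} ⋆ f` for continuous
`f` (`haarConv_haarConv` and the semigroup field of `IsGroupHeatKernel`). [folklore] -/
theorem haarConv_haarConv [T2Space G] (hp : IsGroupHeatKernel p) {s t : ℝ} (hs : 0 < s)
    (ht : 0 < t) {f : G → ℝ} (hf : Continuous f) :
    haarConv (p s) (haarConv (p t) f) = haarConv (p (s + t)) f := by
  rw [QuantumLattice.haarConv_haarConv (hp.continuous hs) (hp.continuous ht) hf]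
  congr 1
  funext g
  exact (hp.semigroup s t hs ht g).symm

/-- Two heat kernels of the same group commute: `p_s ⋆ (q_t ⋆ f) = q_t ⋆ (p_s ⋆ f)` for
continuous `f` (associativity and `p_s ⋆ q_t = q_t ⋆ p_s`, central kernels). [folklore] -/
theorem haarConv_haarConv_comm [T2Space G] {q : ℝ → G → ℝ} (hp : IsGroupHeatKernel p)
    (hq : IsGroupHeatKernel q) {s t : ℝ} (hs : 0 < s) (ht : 0 < t) {f : G → ℝ}
    (hf : Continuous f) :
    haarConv (p s) (haarConv (q t) f) = haarConv (q t) (haarConv (p s) f) := by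
  rw [QuantumLattice.haarConv_haarConv (hp.continuous hs) (hq.continuous ht) hf,
    QuantumLattice.haarConv_haarConv (hq.continuous ht) (hp.continuous hs) hf,
    haarConv_comm_of_central (fun g h => hp.central s hs g h)]

/-- Symmetry of `p_t ⋆` for the Haar pairing on continuous functions. [folklore] -/
theorem integral_haarConv_mul_eq [T2Space G] (hp : IsGroupHeatKernel p) {t : ℝ} (ht : 0 < t)
    {f g : G → ℝ} (hf : Continuous f) (hg : Continuous g) :
    ∫ x, haarConv (p t) f x * g x ∂(haarProbability G) =
      ∫ x, f x * haarConv (p t) g x ∂(haarProbability G) :=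
  QuantumLattice.integral_haarConv_mul_eq (hp.continuous ht) (hp.symm t ht) hf hg

end IsGroupHeatKernel

end Literature.MathematicalPhysics.QuantumLattice
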